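import Summits.ResolutionOfSingularities.ResolutionOfSingularities.Theses.WildCones
import Summits.ResolutionOfSingularities.ResolutionOfSingularities.Theorems.NoPeriodicIsolatedAtom.Negative.FalseWithoutIsol

/-!
# Disproof of `ClassicalRegimes` (crux stmt-ResolutionOfSingularities-16884, route `WildCones`) — work file of the crux-disprover seat

**Findings (cycle 1, 2026-08-17). VERDICT SO FAR: NO KILL — the crux resists; it is almost certainly TRUE.**

Index (prose lives in docstrings; everything named `theorem` below is sorry-free unless marked):

* §0 `crux_iff` — the crux re-pointed, DEFINITIONALLY (`Iff.rfl`), at the mirrored operators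
  `clean bl ord dv tr step run ser pd jac` of `Theorems/NoPeriodicIsolatedAtom/Negative/FalseWithoutIsol.lean`
  (FrobeniusClosing's calculus = this route's, verbatim). Read-back audit of the encoding: §2.
* §1 LOAD-BEARING ANALYSIS (theorems `classicalRegimes_false_without_<H>`; landing copies proposed as
  `Theorems/ClassicalRegimes/Negative/FalseWithoutIsol.lean` (p155982) and `…/FalseWithoutMultP.lean` (p156005)):
  - `Isol` dropped ⇒ FALSE: Whitney umbrella `z² = x²y` over `𝔽₂` (`p = 2 = n`), fixed by the chart-`y` step.
  - `MultP` dropped ⇒ FALSE: smooth branch `z² + u` over `𝔽₂` (`n = 1`), never divided (`S = 0` branch), fixed.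
  - `p.Prime` dropped ⇒ FALSE at the junk value `p = 0` (`ℚ`, `z⁰ + u`): primality is used through `p ≠ 0`.
  - NOT load-bearing (positive facts, on the item from earlier seats, not re-proved here): `0 < n` (at `n = 0`
    the statement is vacuously true: `clean ≡ 0`), `[PerfectField κ]` (runs embed verbatim into any extension with
    `Isol`/`MultP` unchanged ⇒ the prover may take `κ` algebraically closed), and `p.Prime` beyond `p ≠ 0, 1`.
  - `(n ≤ 2 ∨ p = 2)` dropped = the route TARGET `IsolatedForcedTermination` (open; Hauser–Perlega's missing
    forced cycle) — not attackable here by design.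
* §2 WHY IT RESISTS (docstring of `resists`): the encoding is faithful; `n = 1` is two lines; `n = 2` is Lipman
  1978 ∘ (isolated hypersurface point is normal); `p = 2, n ≥ 3` is Case A (char-free, 5-line proof recorded)
  + Morse splitting WITH `z²`-absorption over perfect `κ` (hand derivation recorded, incl. the Arf obstruction and
  why `z²` removes it) + literal persistence of the split form along `Isol ∧ MultP` successors ⇒ descent `n → n−2`.
  Every attack below is an instance of one of these proofs working.
* §3 NATURAL STRENGTHENINGS (numerics, this seat's `exp/*.py` + kit job `j025491`, literal model of the 12 `let`s +
  Milnor numbers by stabilised colength): the lead's one-step Milnor drop `MuDrop p 2 κ` (stub `stub_muDropSurface`)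
  — 18 749 isolated multiplicity-`p` steps (exhaustive small supports `p = 2, 3, 5`; random normal forms
  `p = 3, 5, 7, 11`): 0 violations, minimum margin EXACTLY `p² − p − 1` (1, 5, 19, 41, 109) in every case, attained
  by the closed-form family `y^{p+1} + x^m ↦ xy^{p+1} + x^{m−p}` (`μ: p(m−1) ↦ pm − p² + 1`; E₆/E₈ at `p = 2`) — the
  stub's constant is SHARP (tightness); chains: max depth 18 at `p = 2`, `μ` strictly decreasing on every edge.
* §4 TARGETS (lead's stuck stubs): none handed over yet (payload `stuck_stubs = []`); pre-analysis of the four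
  registered stubs of `Lines/milnor_descent.lean` in the docstring of `targets` (curve: true, `μ = ord − 1`;
  Case A: true, proof sketch; char-two: reduces to surface(p = 2) + curve by the splitting of §2; surface: the only
  stub with content beyond folklore — numerics above, no counterexample).
* §5 NEAR-MISSES: none (nothing sorried in this file).
-/

noncomputable section

-- single-problem summit: the doubled namespace component `ResolutionOfSingularities` is forced by the tree layout
set_option linter.dupNamespace false

namespace Summit.ResolutionOfSingularities.ResolutionOfSingularities.Cruxes.ClassicalRegimes.Disproof

open Summit.ResolutionOfSingularities.ResolutionOfSingularities.Theses.WildCones (ClassicalRegimes)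
open Summit.ResolutionOfSingularities.ResolutionOfSingularities.Theorems.NoPeriodicIsolatedAtom.Negative
  (clean bl ord dv tr step run ser pd jac umbrella run_umbrella multP_umbrella)
open scoped BigOperators Classical

/-! ## §0 Re-pointing the crux (definitional) -/

/-- **The mirror is exact**: `ClassicalRegimes` is, definitionally, the proposition below over the mirrored
operators (`Isol` = `Module.Finite κ (κ[[u]] ⧸ jac …)`, `MultP` = the cleaned state is non-zero of order `≥ p`,
displayed inline). [folklore] -/
theorem crux_iff :
    ClassicalRegimes ↔
      ∀ p : ℕ, p.Prime → ∀ n : ℕ, 0 < n → (n ≤ 2 ∨ p = 2) → ∀ (κ : Type) [Field κ] [CharP κ p] [PerfectField κ]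
        (c₀ : (Fin n → ℕ) → κ) (i : ℕ → Fin n) (t : ℕ → Fin n → κ),
        ¬ (∀ m, Module.Finite κ (MvPowerSeries (Fin n) κ ⧸ jac p (run p c₀ i t m)) ∧
          ((∃ A, clean p (run p c₀ i t m) A ≠ 0) ∧
            ∀ A, clean p (run p c₀ i t m) A ≠ 0 → p ≤ Finset.sum Finset.univ (fun j => A j))) :=
  Iff.rfl

/-! ## §1 Load-bearing analysis

`<Crux>Without<H>` is displayed INLINE as the right-hand side of `crux_iff` with exactly one hypothesis /
conjunct deleted (no `def … : Prop` under `Summits/`, per the fact discipline); the theorem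
`classicalRegimes_false_without_<H>` refutes it with an explicit eternal run. -/

/-- **`Isol` is load-bearing.** RHS of `crux_iff` with the isolatedness conjunct deleted: false at
`(p, n, κ) = (2, 2, 𝔽₂)` — the Whitney umbrella `z² = x²y` along the constant chart word `y`, zero translations
(`x²y ↦ x²y³ ↦ x²y³/y² = x²y`), multiplicity `2` throughout, singular along the `y`-axis. Inside BOTH classical
regimes. (Landing copy: `Theorems/ClassicalRegimes/Negative/FalseWithoutIsol.lean`.)
[cite: HauserPerlega2019, §1 p. 3 (cycles are easy once the choice of centres is not forced)] -/
theorem classicalRegimes_false_without_Isol :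
    ¬ ∀ p : ℕ, p.Prime → ∀ n : ℕ, 0 < n → (n ≤ 2 ∨ p = 2) → ∀ (κ : Type) [Field κ] [CharP κ p] [PerfectField κ]
        (c₀ : (Fin n → ℕ) → κ) (i : ℕ → Fin n) (t : ℕ → Fin n → κ),
        ¬ (∀ m, ((∃ A, clean p (run p c₀ i t m) A ≠ 0) ∧
            ∀ A, clean p (run p c₀ i t m) A ≠ 0 → p ≤ Finset.sum Finset.univ (fun j => A j))) := by
  intro h
  haveI : PerfectField (ZMod 2) := PerfectField.ofFinite
  exact h 2 Nat.prime_two 2 two_pos (Or.inl le_rfl) (ZMod 2) umbrella (fun _ => 1) (fun _ _ => 0)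
    (fun m => by rw [run_umbrella]; exact multP_umbrella)

/-! ## The smooth branch `z^p + u` (`n = 1`) is a fixed point of the dynamics whenever `p ≠ 1` -/

/-- The smooth-branch state `a(u) = u` in one variable: coefficient `1` on the exponent `(1)`, `0`
elsewhere. [folklore] -/
def lineGerm (κ : Type) [Field κ] : (Fin 1 → ℕ) → κ := fun A => if A = ![1] then 1 else 0

variable {κ : Type} [Field κ]

/-- `lineGerm` is supported exactly on the exponent `(1)`. [folklore] -/
lemma lineGerm_ne_zero_iff (A : Fin 1 → ℕ) : lineGerm κ A ≠ 0 ↔ A = ![1] := by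
  unfold lineGerm
  by_cases h : A = ![1] <;> simp [h]

/-- `u` is `p`-clean for every `p ≠ 1` (the exponent `1` is not divisible by `p`). [folklore] -/
lemma clean_lineGerm {p : ℕ} (hp : p ≠ 1) : clean p (lineGerm κ) = lineGerm κ := by
  funext A
  unfold clean
  by_cases h : ∀ j, p ∣ A j
  · rw [if_pos h]
    by_cases hA : A = ![1]
    · exact absurd (Nat.dvd_one.mp (by simpa [hA] using h 0)) hp
    · simp [lineGerm, hA]
  · rw [if_neg h]

/-- The order of `u` is `1`. [folklore] -/
lemma ord_lineGerm : ord (lineGerm κ) = 1 := by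
  unfold ord
  have hset : {m : ℕ | ∃ A, lineGerm κ A ≠ 0 ∧ m = Finset.sum Finset.univ (fun j => A j)} = {1} := by
    ext m
    simp only [Set.mem_setOf_eq, Set.mem_singleton_iff, lineGerm_ne_zero_iff]
    constructor
    · rintro ⟨A, rfl, rfl⟩
      simp
    · rintro rfl
      exact ⟨![1], rfl, by simp⟩
  rw [hset, csInf_singleton]

/-- In one variable the (only) blow-up chart is the identity on coefficient functions. [folklore] -/
lemma bl_one (c : (Fin 1 → ℕ) → κ) : bl 0 c = c := by
  funext B
  unfold bl
  have h0 : Finset.univ.erase (0 : Fin 1) = ∅ := by decide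
  simp only [h0, Finset.sum_empty, zero_le, if_true, Nat.sub_zero, Function.update_eq_self]

/-- Dividing by `u_i^0` is the identity. [folklore] -/
lemma dv_zero' {n : ℕ} (i : Fin n) (c : (Fin n → ℕ) → κ) : dv i 0 c = c := by
  funext B
  unfold dv
  simp

/-- In one variable the translation step is the identity (there is no second variable to translate;
only `D = 0` contributes to the sum). [folklore] -/
lemma tr_one (τ : Fin 1 → κ) (s : ℕ) (c : (Fin 1 → ℕ) → κ) : tr 0 τ s c = c := by
  funext B
  unfold tr
  rw [Finset.sum_eq_single (0 : Fin 1 → ℕ)]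
  · simp
  · intro D _ hD
    have : D 0 ≠ 0 := by
      intro h0; apply hD; funext j; fin_cases j; exact h0
    rw [if_neg this]
  · intro h
    exact absurd (by simp [Fintype.mem_piFinset]) h

/-- For `p ≠ 1` the division exponent `ite (p ≤ 1) p 0` at cleaned order `1` is `0`: at `p = 0` both
branches are `0`, at `p ≥ 2` the test `p ≤ 1` fails. [folklore] -/
lemma div_exponent_eq_zero {p : ℕ} (hp : p ≠ 1) : (@ite ℕ (p ≤ 1) (Classical.dec _) p 0) = 0 := by
  by_cases h : p ≤ 1
  · rw [if_pos h]; omega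
  · rw [if_neg h]

/-- **Fixed point**: for `p ≠ 1`, one step of the dynamics (the chart is forced, the translation is
arbitrary) maps `u` to itself — no division happens. [folklore] -/
lemma step_lineGerm {p : ℕ} (hp : p ≠ 1) (i : Fin 1) (τ : Fin 1 → κ) :
    step p i τ (lineGerm κ) = lineGerm κ := by
  have hi : i = 0 := Subsingleton.elim _ _
  subst hi
  unfold step
  rw [clean_lineGerm hp, ord_lineGerm, div_exponent_eq_zero hp, bl_one, dv_zero', tr_one,
    clean_lineGerm hp]

/-- Hence every run from `u` is constant (`p ≠ 1`). [folklore] -/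
lemma run_lineGerm {p : ℕ} (hp : p ≠ 1) (i : ℕ → Fin 1) (t : ℕ → Fin 1 → κ) (m : ℕ) :
    run p (lineGerm κ) i t m = lineGerm κ := by
  induction m with
  | zero => rfl
  | succ m ih =>
    show step p (i m) (t m) (run p (lineGerm κ) i t m) = lineGerm κ
    rw [ih, step_lineGerm hp]

/-- `∂u/∂u = 1` as a formal power series (`p ≠ 1`, so `u` survives cleaning). [folklore] -/
lemma pd_ser_lineGerm {p : ℕ} (hp : p ≠ 1) : pd 0 (ser p (lineGerm κ)) = 1 := by
  ext A
  rw [MvPowerSeries.coeff_one]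
  change ((A 0 + 1 : ℕ) : κ) * clean p (lineGerm κ) (⇑((A + Finsupp.single (0 : Fin 1) 1 : Fin 1 →₀ ℕ))) = _
  rw [clean_lineGerm hp]
  unfold lineGerm
  have key : ((⇑((A + Finsupp.single (0 : Fin 1) 1 : Fin 1 →₀ ℕ))) = ![1]) ↔ A = 0 := by
    constructor
    · intro h
      have h0 := congrFun h 0
      simp at h0
      ext
      simpa [Fin.default_eq_zero] using h0
    · rintro rfl
      funext j
      have hj : j = 0 := Subsingleton.elim _ _
      subst hj
      simp
  by_cases hA : A = 0
  · rw [if_pos (key.mpr hA), if_pos hA]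
    subst hA
    simp
  · rw [if_neg (fun h => hA (key.mp h)), if_neg hA, mul_zero]

/-- The Jacobian ideal of `u` is the unit ideal. [folklore] -/
lemma jac_lineGerm {p : ℕ} (hp : p ≠ 1) : jac p (lineGerm κ) = ⊤ := by
  unfold jac
  rw [Ideal.eq_top_iff_one]
  exact Ideal.subset_span ⟨0, pd_ser_lineGerm hp⟩

/-- `u` is ISOLATED: `κ[[u]]/(1) = 0` is finite over `κ`. [folklore] -/
lemma isol_lineGerm {p : ℕ} (hp : p ≠ 1) :
    Module.Finite κ (MvPowerSeries (Fin 1) κ ⧸ jac p (lineGerm κ)) := by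
  rw [jac_lineGerm hp]
  haveI : Subsingleton (MvPowerSeries (Fin 1) κ ⧸ (⊤ : Ideal (MvPowerSeries (Fin 1) κ))) :=
    Ideal.Quotient.subsingleton_iff.mpr rfl
  exact Module.Finite.of_finite


/-- **`MultP` is load-bearing.** RHS of `crux_iff` with the multiplicity conjunct deleted: false at
`(p, n, κ) = (2, 1, 𝔽₂)` — the smooth branch `z² + u` is isolated (`jac = ⊤`) and is never divided (cleaned order
`1 < 2`, so the division exponent is `0`): an eternal isolated run. (Landing copy:
`Theorems/ClassicalRegimes/Negative/FalseWithoutMultP.lean`.) [folklore] -/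
theorem classicalRegimes_false_without_MultP :
    ¬ ∀ p : ℕ, p.Prime → ∀ n : ℕ, 0 < n → (n ≤ 2 ∨ p = 2) → ∀ (κ : Type) [Field κ] [CharP κ p] [PerfectField κ]
        (c₀ : (Fin n → ℕ) → κ) (i : ℕ → Fin n) (t : ℕ → Fin n → κ),
        ¬ (∀ m, Module.Finite κ (MvPowerSeries (Fin n) κ ⧸ jac p (run p c₀ i t m))) := by
  intro h
  haveI : PerfectField (ZMod 2) := PerfectField.ofFinite
  exact h 2 Nat.prime_two 1 one_pos (Or.inl (by norm_num)) (ZMod 2) (lineGerm (ZMod 2)) (fun _ => 0) (fun _ _ => 0)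
    (fun m => by rw [run_lineGerm (by norm_num)]; exact isol_lineGerm (by norm_num))

/-- **`p.Prime` is load-bearing (junk value `p = 0`).** RHS of `crux_iff` with `p.Prime →` deleted: false at
`(p, n, κ) = (0, 1, ℚ)` — `0`-cleaning keeps `u`, the division exponent is `0` in both branches, `MultP`'s order
clause reads `0 ≤ |A|`: `z⁰ + u` is an eternal isolated run. Primality enters through `p ≠ 0` (and `p ≠ 1` is
forced by `CharP κ 1 → False`); nothing in the three regimes' proofs uses more. (Landing copy:
`Theorems/ClassicalRegimes/Negative/FalseWithoutMultP.lean`.) [folklore] -/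
theorem classicalRegimes_false_without_Prime :
    ¬ ∀ p : ℕ, ∀ n : ℕ, 0 < n → (n ≤ 2 ∨ p = 2) → ∀ (κ : Type) [Field κ] [CharP κ p] [PerfectField κ]
        (c₀ : (Fin n → ℕ) → κ) (i : ℕ → Fin n) (t : ℕ → Fin n → κ),
        ¬ (∀ m, Module.Finite κ (MvPowerSeries (Fin n) κ ⧸ jac p (run p c₀ i t m)) ∧
          ((∃ A, clean p (run p c₀ i t m) A ≠ 0) ∧
            ∀ A, clean p (run p c₀ i t m) A ≠ 0 → p ≤ Finset.sum Finset.univ (fun j => A j))) := by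
  intro h
  haveI : CharP ℚ 0 := CharP.ofCharZero ℚ
  refine h 0 1 one_pos (Or.inl (by norm_num)) ℚ (lineGerm ℚ) (fun _ => 0) (fun _ _ => 0) (fun m => ?_)
  rw [run_lineGerm (by norm_num)]
  refine ⟨isol_lineGerm (by norm_num), ?_, fun A _ => Nat.zero_le _⟩
  rw [clean_lineGerm (by norm_num)]
  exact ⟨![1], by simp [lineGerm]⟩

/-! ## §2 Why the crux resists (cycle 1) -/

/-- **WHY IT RESISTS** — the record of this seat's attacks on the crux itself; every attack is an instance of
one of three classical proofs working. Nothing to prove here (`True`); the content is this docstring.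

**Encoding audit (read back symbol by symbol; no junk found).** `clean` deletes exactly the `p`-th-power
monomials (a `z`-shift `z ↦ z + Σ c_A^{1/p} u^{A/p}`, legitimate over perfect `κ`); `bl i` is the total transform
in the chart `u_i` (`u_j = u_i v_j`), `dv i p` the strict transform (division by `u_i^p`, taken iff the cleaned
order is `≥ p`, which `MultP` guarantees along a run); `tr i τ` translates `v_j ↦ v_j + τ_j (j ≠ i)` — its range
bound `D_j ≤ B_i + s` never bites because the support of `dv i s (bl i c)` satisfies `Σ_{j≠i} B_j ≤ B_i + s`;
`τ_j ^ 0 = 1` makes `τ = 0` the identity; the `z`-chart is not needed (the strict transform misses its origin, and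
every other point of the exceptional divisor lies in some `u_i`-chart); over perfect `κ` the points of
`X' ∩ E ∩ {u_i-chart}` are in bijection with `τ ∈ κ^{n-1}` (purely inseparable cover of `E`), so EVERY `κ`-rational
infinitely near point is a `(i, τ)`; `Isol c` ⟺ `κ[[u]]/(∂a)` finite ⟺ `Sing(z^p + a) = {pt}` (`∂_z z^p = 0`);
`MultP c` ⟺ `clean a ≠ 0 ∧ ord (clean a) ≥ p` ⟺ the local ring is REDUCED (a cleaned non-zero `a` is not a
`p`-th power in `κ((u))`) of multiplicity exactly `p`; the completed local ring of the blow-up at the point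
`(i, τ)` IS `κ[[z', v]]/(z'^p + step i τ c)` (blow-up of a regular-sequence ideal commutes with completion). Hence
the crux ⟺ "over a perfect (WLOG algebraically closed: base change keeps `Isol`, `MultP`) field of
characteristic `p`, in the regimes `n ≤ 2 ∨ p = 2`, the height-one atom `z^p + a(u_1..u_n)` has no infinite chain
of infinitely near, isolated, `p`-fold closed points" — a statement about complete local rings, invariant under
formal coordinate changes at every stage.

**`n = 1`.** `bl = tr = id`, a step is `a ↦ clean (a / u^p) = a / u^p`; the cleaned order drops by exactly `p`,
so `MultP` fails after `⌊ord a / p⌋` steps. (Attack: none possible; `FalseWithoutMultP` shows the exit IS `MultP`.)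

**`n = 2`.** An isolated hypersurface point of a surface is normal (`S₂ + R₁`), so the normalisation in Lipman's
tower `X ← N(Bl X) ← …` is an isomorphism near every point of our chain; the chain of completed local rings embeds
in Lipman's sequence for the excellent reduced surface `Spec κ[[u₁,u₂]][z]/(z^p + a)`, which is regular after
finitely many steps [Lipman 1978; Liu Thm 8.3.44; in tree `Lipman1978SequenceFinite` (finite type only — the
prover needs the EXCELLENT form, or CJS 2020 Cor 6.18 + `Scheme.no_infinite_hsFun_tower_of_isExcellent`)].
Direct structure found by this seat (useful to the prover, all `p`): along an `Isol ∧ MultP` step at `n = 2`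
(chart `u₁`, WLOG `τ = 0` by the linear change `u₂ ↦ u₂ + τu₁`, which commutes with the chart and preserves
`Isol`, `MultP`, `μ`): (i) cleaned order exactly `p` ⇒ NO multiplicity-`p` successor (`a_p(1, v)` is a polynomial of
degree `≤ p − 1` without constant term; order `≥ p` after translation forces it to vanish); (ii) order `≥ p + 2` ⇒
every successor is non-isolated (`∂a' ⊂ (v₁)`); (iii) order `p + 1` and `MultP` at `τ = 0` ⟺ `a_{p+k} ∈ (u₂^{p−k})`
for `k = 1 … p−1` — the near direction is a root of multiplicity `≥ p − 1` of the tangent cone. Attacks: literal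
model of the dynamics + Milnor numbers (`exp/dyn.py`), exhaustive small supports and random normal forms (§3):
every chain terminates, `μ` strictly drops.

**`p = 2`, `n ≥ 3`.** CASE A (char-free): if `ord (clean a) = m ≥ p + 1` then every monomial of
`a' = tr (dv (bl (clean a)))` has `v_i`-exponent `≥ m − p ≥ 1` (translation does not touch `v_i`), so
`∂_j a'' ∈ (v_i)` for `j ≠ i` (`a'' = clean a'`), and `V(∂a'') ⊇ V(v_i, ∂_i a'')`, of dimension `≥ n − 2 ≥ 1`
unless `∂_i a''(0) ≠ 0`, i.e. unless `a''` has the linear monomial `v_i` (then `MultP` fails): no `Isol ∧ MultP`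
successor. So every state of an infinite run has cleaned order EXACTLY 2: `a = Σ_{i<j} c_{ij} u_i u_j + …` with some
`c_{ij} ≠ 0` (squares are cleaned). SPLITTING over perfect `κ` WITH the `z²` (hand derivation, this seat): formal
IFT on `(∂₁a, ∂₂a)` (Jacobian `[[0,1],[1,0]]` in char 2) gives `a = h(x'') + A x₁² + x₁x₂ + C x₂²` after
`x₁ ↦ x₁/B`; write `A = α² + A_o`, `C = γ² + C_o` (even part = square over perfect `κ`; odd parts lie in `𝔪`);
`z ↦ z + αx₁ + γx₂` absorbs the squares — THIS is where the Arf obstruction of the `z`-free splitting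
(`x₁x₂ + ax₁² + cx₂²` anisotropic over `𝔽₂`) disappears; then `x₂ ↦ x₂ + A_o x₁`, `x₁ ↦ x₁ + C x₂` alternately
converge `𝔪`-adically (the `x₁²`-coefficient is multiplied by `C A ∈ 𝔪²` per round) to `z'² + y₁y₂ + h(x'')`
[cf. Greuel–Pfister, J. Algebra 689 (2026) Thm 3.5 / Cor 3.7 = arXiv:2507.17078]. PERSISTENCE (literal, in the
dynamics' own coordinates): the successors of `x₁x₂ + g(x'')` are — chart `x₁` or `x₂`: linear term survives,
`MultP` fails; chart `x_j (j ≥ 3)` at `τ`: `w₁w₂ + τ₂w₁ + τ₁w₂ + step_j^{(n−2)} τ'' g`, so `MultP` forces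
`τ₁ = τ₂ = 0` and the successor is `w₁w₂ + g'` with `g'` the `(n−2)`-variable step of `g`; `Isol(x₁x₂ + g) ⟺ Isol(g)`
(`κ[[x]]/(x₂, x₁, ∂g) = κ[[x'']]/(∂g)`), `MultP` likewise (`clean g' ≠ 0` from `Isol g'` when `n − 2 ≥ 1`). With the
dictionary (stagewise isomorphic complete local rings; intrinsic `Isol`/`MultP`) an infinite run in `n` variables
yields one in `n − 2`; induction ends in `n ∈ {1, 2}`. The why-might-fail of the item ("translation may un-split
the quadratic part") does not happen: a translation with `(τ₁, τ₂) ≠ 0` kills `MultP` on the spot.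

**What a counterexample would have to be.** By the above, only a failure of the DICTIONARY could make the typed
crux false while the geometry is true; the audit found none (the two places where typed ≠ geometric a priori —
the `tr` range bound and the missing `z`-chart — are provably harmless). [folklore] -/
theorem resists : True := trivial

/-! ## §3 Natural strengthenings and tightness (numerics + one closed-form family; no Lean content yet)

The lead's line `milnor_descent` replaces the crux by the ONE-STEP MILNOR DROP `MuDrop p n κ`
(`Isol c → MultP c → Isol c' → MultP c' → μ c' < μ c`, `c' = step i τ c`) in the three regimes, with the
quantitative claim `μ c' ≤ μ c − (p² − p − 1)` at `n = 2`. This seat's numerics (literal model of the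
`let`-calculus over `𝔽_p`, `μ` = stabilised colength `dim κ[u]/(∂a + 𝔪^N)`, `N ↑` until `d_N = d_{N+1}`, exact by
Nakayama), chart `u₁`, `τ = 0` (WLOG, §2). BATCHED SWEEP = kit job `j025491` (8 cores, 113 s wall; table
`NUMERICS-j025491.md` attached to the item), states of cleaned order exactly `p + 1` in the normal form
`a_{p+k} ∈ (u₂^{p−k}) (k < p)` forced by a `MultP` successor:

| case | isolated steps with `Isol ∧ MultP` successor | violations (`μ' ≥ μ`) | min margin | `p² − p − 1` |
|---|---|---|---|---|
| `p = 2`, supports `≤ 3`, degrees `3…10`, exhaustive | 982 | 0 | 1 | 1 |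
| `p = 2`, supports `≤ 4`, degrees `3…8`, exhaustive | 4589 | 0 | 1 | 1 |
| `p = 3`, supports `≤ 3`, degrees `4…9`, exhaustive | 1804 | 0 | 5 | 5 |
| `p = 5`, supports `≤ 2`, degrees `6…11`, exhaustive | 24 | 0 | 19 | 19 |
| `p = 3`, random normal forms, degrees `≤ 10` | 6000 | 0 | 5 | 5 |
| `p = 5`, random, degrees `≤ 12` | 4000 | 0 | 19 | 19 |
| `p = 7`, random, degrees `≤ 16` | 1200 | 0 | 41 | 41 |
| `p = 11`, random, degrees `≤ 23` | 150 | 0 | 109 | 109 |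

18 749 one-step tests, 0 violations, minimum margin `= p² − p − 1` in EVERY case. CHAINS (all charts, all
translations over `𝔽_p`, DFS over `Isol ∧ MultP` successors): `p = 2` (429 starts, supports `≤ 3`, degrees `≤ 8`):
max depth 18 (from `y⁷ + x²y + x⁷y`, `μ = 38`); `p = 3`: depth `≤ 2`; `p = 5`: depth `≤ 1`; `μ` strictly decreasing
along every one of the explored edges (0 violations). So within these boxes the lead's stub holds with the stated
constant, and the crux (finiteness of chains) holds with room to spare.

* **TIGHTNESS — closed form (this seat; by hand, all primes `p`, confirmed by the model for `p ≤ 11`).** For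
  `m > p + 1`, `p ∤ m`: the state `a = y^{p+1} + x^m` is isolated with `μ(a) = p(m − 1)`
  (`∂a = (m x^{m−1}, y^p)`); its chart-`x` successor at `τ = 0` is `a' = x y^{p+1} + x^{m−p}`, isolated of
  multiplicity `p` with `μ(a') = I(y^{p+1} + (m−p)x^{m−p−1}, xy^p) = (p + 1) + p(m − p − 1) = pm − p² + 1`; hence
  `μ(a) − μ(a') = p² − p − 1` EXACTLY, for every `m`. (At `p = 2` this is the E₆/E₈ family `y³ + x^{2k+1}`.) A second
  sharp family for odd `p`: `y^{p+1} + x^{2p−2}y ↦ xy^{p+1} + x^{p−1}y`, `μ: 2p² − p − 2 ↦ p² − 1`. So the constant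
  `p² − p − 1` in `stub_muDropSurface`'s docstring cannot be improved, and any proof via Noether's formula must be an
  equality computation on these families (no slack to absorb a non-generic-coordinates error term).
* `p = 2`, `n = 3, 4`: by the splitting of §2, `MuDrop` at cleaned order 2 reduces to the surface/curve drop for
  the residual part `g` (`μ(x₁x₂ + g) = μ(g)`), so no separate search is informative beyond `n = 2` (the earlier
  refuter seat's direct `n = 3, 4` runs: margins `≥ 1`, chains of depth `μ/2 − 1`).
A violation of `MuDrop p 2 κ` would be filed at once as `stub-false: stub_muDropSurface`; none found. -/

/-! ## §4 Targets (lead's stuck stubs) — none handed over yet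

Pre-analysis of the registered stubs of `Lines/milnor_descent.lean` (sha 5b96e93b…):
* `stub_muDropCurve` — TRUE and elementary (`μ = ord(clean a) − 1`, a step divides by `u^p`).
* `stub_caseAExit` — TRUE, char-free; the 5-line proof is in §2 (all `∂_j a'' ∈ (v_i)`, `j ≠ i`).
* `stub_muDropCharTwo` — reduces to `stub_muDropSurface (p = 2)` + curve case by the splitting WITH `z²` of §2
  (`μ` is invariant under formal coordinate change and under adding squares; the split form persists literally).
  The stub's own docstring route ("critical submanifold") is the same reduction phrased without coordinates.
* `stub_muDropSurface` — the only stub with non-folklore content; numerics §3, no counterexample; its derivation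
  via Noether's formula needs the generic-coordinate proviso (`[0:1]` off the tangent cone AND `x ∤ Q̂, Ĥ` jointly —
  e.g. `a = x²y + xy⁴` at `p = 2` has `I(H, Q) = ∞` in the given coordinates although `μ = 8 ↦ 1` drops fine).
-/

/-! ## §5 Near-misses — none (nothing in this file is sorried). -/

end Summit.ResolutionOfSingularities.ResolutionOfSingularities.Cruxes.ClassicalRegimes.Disproof

end
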